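import Mathlib
import HarnessLib
import Summits.SmoothPoincare4.SmoothPoincare4.Theses.RootDecompC
import Summits.SmoothPoincare4.SmoothPoincare4.Theses.ThreeFibres
import Literature.Topology.FourManifolds.SphereFamilySurgery

/-!
# LINE «killer_length» (decomp-sp4 lens-3 gen 14; vehicle B″) under the layer-2 crux
C.StableMirrorCancellation = stmt-SmoothPoincare4-28014 (route-SmoothPoincare4-RootDecompC rev 2; tree file imported BY NAME, unchanged).

  MCS #28014 ⟸ [#13903 `ThreeFibres.SurgeryDictionary` BY NAME, binder — as in the registered lines «twin_separation» / «killer_shape»]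
             ∧ stub_twinSeparation  [E-column · byte-identical to «twin_separation» / «killer_shape» stub (COUNT ONCE)]
             ∧ stub_transport       [dictionary support · COSTUME(cite GompfStipsicz1999 §5.2) · byte-identical to «killer_shape» stub]
             ∧ stub_dualOnceOff     [FLOOR RUNG ℓ = 1 · Gabai LBT (arXiv:1705.09989 Thm 1.9) · byte-identical to «killer_shape» stub (COUNT ONCE)]
             ∧ stub_lengthThree     [NEW RUNG ℓ = 3 · species R · WEAKER · UNDECIDED · ATTACKABLE · INSTRUMENTABLE: not dual-once as given,
                                     some coordinate section three-sheeted (killer of meridional length ≤ 3) ⟹ M ≅ S⁴; decided sub-rows =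
                                     THEOREM B of the node (all fusion-one ribbon rows (K_w, a²b⁻¹ ∣ b²a⁻¹), both framings, AC substitution);
                                     mechanism for the rest: LBT + ONE Whitney pair, obstruction = W ∩ C (Casson–Whitney count)]
             ∧ stub_lengthTail      [LOAD-BEARING · species R · complement AS GIVEN; by the kernel certificate
                                     `KillerLength.lengthTail_iff_satl : FoldMove → (LT ⟺ SATL)` it is SATL in costume, so its honest
                                     content is SATL's with the honest specimens = killers of length ≥ 5 (T-KILLER-R length-5 column)]
Composition `StableMirrorCancellation_of` is sorry-free (W1 form: foreign item as binder, local stubs by name, all USED);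
sorries = the 5 stubs. Kernel record: HOME/decomp-sp4-lens-3/v14/KillerLengthV14.lean (`stableMirrorCancellation28014_of_cells`,
`satl_iff_cells`, `nonDual_iff_cells`).
Relation to the registered lines: B″ = «killer_shape» with stub_nonDualKiller ⟸ stub_lengthThree ∧ stub_lengthTail
(kernel `nonDual_iff_cells`, exact); «twin_separation» stays primary; one landing of a shared stub closes it in all three lines by `exact`.
-/

open scoped Manifold ContDiff

set_option linter.dupNamespace false

namespace Summit.SmoothPoincare4.SmoothPoincare4.Cruxes.StableMirrorCancellation.KillerLength

open Summit.SmoothPoincare4.SmoothPoincare4.Theses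

/-- stub · E-column (twin separation; = lines «twin_separation» / «killer_shape» stub_twinSeparation verbatim; species E, pooled, COUNT ONCE). -/
theorem stub_twinSeparation : open scoped ContDiff in ∀ ν : Literature.Topology.FourManifolds.FramedSphereFamily ((𝓡 2).prod (𝓡 2)) ((Metric.sphere (0 : EuclideanSpace ℝ (Fin 3)) 1) × (Metric.sphere (0 : EuclideanSpace ℝ (Fin 3)) 1)) (Fin 1) 2 2, Manifold.IsSmoothEmbedding (𝓡 2) ((𝓡 2).prod (𝓡 2)) ∞ (ν.sphere 0) → (∃ (x : Metric.sphere (0 : EuclideanSpace ℝ (Fin 3)) 1) (F G : C(Metric.sphere (0 : EuclideanSpace ℝ (Fin 3)) 1, (Metric.sphere (0 : EuclideanSpace ℝ (Fin 3)) 1) × (Metric.sphere (0 : EuclideanSpace ℝ (Fin 3)) 1))), ⇑F = ν.sphere 0 ∧ ⇑G = (fun p => (x, p)) ∧ F.Homotopic G) → SimplyConnectedSpace ↥(Set.range (ν.sphere 0))ᶜ → (∃ (ψ : ((Metric.sphere (0 : EuclideanSpace ℝ (Fin 3)) 1) × (Metric.sphere (0 : EuclideanSpace ℝ (Fin 3))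 1)) ≃ₘ⟮(𝓡 2).prod (𝓡 2), (𝓡 2).prod (𝓡 2)⟯ ((Metric.sphere (0 : EuclideanSpace ℝ (Fin 3)) 1) × (Metric.sphere (0 : EuclideanSpace ℝ (Fin 3)) 1))) (x' : Metric.sphere (0 : EuclideanSpace ℝ (Fin 3)) 1), ∀ p, (ψ (ν.sphere 0 p)).1 ≠ x') := by
  sorry

/-- stub · dictionary support · COSTUME(cite): presentation transport (= «killer_shape» stub_transport verbatim). -/
theorem stub_transport : open scoped ContDiff in ∀ (M : Type) [TopologicalSpace M] [T2Space M] [SecondCountableTopology M] [ChartedSpace (EuclideanSpace ℝ (Fin 4)) M] [IsManifold (𝓡 4) ∞ M], ContinuousMap.HomotopyEquiv M (Metric.sphere (0 : EuclideanSpace ℝ (Fin 5)) 1) → ∀ ν : Literature.Topology.FourManifolds.FramedSphereFamily ((𝓡 2).prod (𝓡 2)) ((Metric.sphere (0 : EuclideanSpace ℝ (Fin 3)) 1) × (Metric.sphere (0 : EuclideanSpace ℝ (Fin 3)) 1)) (Fin 1) 2 2, Manifold.IsSmoothEmbedding (𝓡 2) ((𝓡 2).prod (𝓡 2)) ∞ (ν.sphere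 0) → (∃ (x : Metric.sphere (0 : EuclideanSpace ℝ (Fin 3)) 1) (F G : C(Metric.sphere (0 : EuclideanSpace ℝ (Fin 3)) 1, (Metric.sphere (0 : EuclideanSpace ℝ (Fin 3)) 1) × (Metric.sphere (0 : EuclideanSpace ℝ (Fin 3)) 1))), ⇑F = ν.sphere 0 ∧ ⇑G = (fun p => (x, p)) ∧ F.Homotopic G) → SimplyConnectedSpace ↥(Set.range (ν.sphere 0))ᶜ → ν.IsSurgery (𝓡 4) M → (∃ (ψ : ((Metric.sphere (0 : EuclideanSpace ℝ (Fin 3)) 1) × (Metric.sphere (0 : EuclideanSpace ℝ (Fin 3)) 1)) ≃ₘ⟮(𝓡 2).prod (𝓡 2), (𝓡 2).prod (𝓡 2)⟯ ((Metric.sphere (0 : EuclideanSpace ℝ (Fin 3)) 1) × (Metric.sphere (0 : EuclideanSpace ℝ (Fin 3)) 1))) (x' : Metric.sphere (0 : EuclideanSpace ℝ (Fin 3)) 1), ∀ p, (ψ (ν.sphere 0 p)).1 ≠ x') → ∃ ν' : Literature.Topology.FourManifolds.FramedSphereFamily ((𝓡 2).prod (𝓡 2)) ((Metric.sphere (0 :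 EuclideanSpace ℝ (Fin 3)) 1) × (Metric.sphere (0 : EuclideanSpace ℝ (Fin 3)) 1)) (Fin 1) 2 2, Manifold.IsSmoothEmbedding (𝓡 2) ((𝓡 2).prod (𝓡 2)) ∞ (ν'.sphere 0) ∧ (∃ (x : Metric.sphere (0 : EuclideanSpace ℝ (Fin 3)) 1) (F G : C(Metric.sphere (0 : EuclideanSpace ℝ (Fin 3)) 1, (Metric.sphere (0 : EuclideanSpace ℝ (Fin 3)) 1) × (Metric.sphere (0 : EuclideanSpace ℝ (Fin 3)) 1))), ⇑F = ν'.sphere 0 ∧ ⇑G = (fun p => (x, p)) ∧ F.Homotopic G) ∧ SimplyConnectedSpace ↥(Set.range (ν'.sphere 0))ᶜ ∧ ν'.IsSurgery (𝓡 4) M ∧ (∃ x' : Metric.sphere (0 : EuclideanSpace ℝ (Fin 3)) 1, ∀ p, (ν'.sphere 0 p).1 ≠ x') := by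
  sorry

/-- stub · FLOOR RUNG ℓ = 1 · Gabai LBT: dual-once ∣ off-fibre cancellation (= «killer_shape» stub_dualOnceOff verbatim, COUNT ONCE). -/
theorem stub_dualOnceOff : open scoped ContDiff in ∀ (M : Type) [TopologicalSpace M] [T2Space M] [SecondCountableTopology M] [ChartedSpace (EuclideanSpace ℝ (Fin 4)) M] [IsManifold (𝓡 4) ∞ M], ContinuousMap.HomotopyEquiv M (Metric.sphere (0 : EuclideanSpace ℝ (Fin 5)) 1) → ∀ ν : Literature.Topology.FourManifolds.FramedSphereFamily ((𝓡 2).prod (𝓡 2)) ((Metric.sphere (0 : EuclideanSpace ℝ (Fin 3)) 1) × (Metric.sphere (0 : EuclideanSpace ℝ (Fin 3)) 1)) (Fin 1) 2 2, Manifold.IsSmoothEmbedding (𝓡 2) ((𝓡 2).prod (𝓡 2)) ∞ (ν.sphere 0) → (∃ (x : Metric.sphere (0 : EuclideanSpace ℝ (Fin 3)) 1) (F G : C(Metric.sphere (0 : EuclideanSpace ℝ (Fin 3)) 1, (Metric.sphere (0 : EuclideanSpace ℝ (Fin 3)) 1) × (Metric.sphere (0 : EuclideanSpace ℝ (Fin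 3)) 1))), ⇑F = ν.sphere 0 ∧ ⇑G = (fun p => (x, p)) ∧ F.Homotopic G) → SimplyConnectedSpace ↥(Set.range (ν.sphere 0))ᶜ → ν.IsSurgery (𝓡 4) M → (∃ x' : Metric.sphere (0 : EuclideanSpace ℝ (Fin 3)) 1, ∀ p, (ν.sphere 0 p).1 ≠ x') → (∃ y₀ : Metric.sphere (0 : EuclideanSpace ℝ (Fin 3)) 1, ∃! p : Metric.sphere (0 : EuclideanSpace ℝ (Fin 3)) 1, (ν.sphere 0 p).2 = y₀) → Nonempty (M ≃ₘ⟮𝓡 4, 𝓡 4⟯ Metric.sphere (0 : EuclideanSpace ℝ (Fin 5)) 1) := by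
  sorry

/-- stub · NEW RUNG ℓ = 3 · species R · WEAKER · UNDECIDED · ATTACKABLE: length-three cancellation — off-fibre, not dual-once as given, some coordinate section `𝕊²×{y}` (all `y` near `y₀`) meets the core in ≤ 3 points ⟹ `M ≅ S⁴`. Decided sub-rows: every fusion-one ribbon 2-knot `K_w` with killer `a²b⁻¹` or `b²a⁻¹` (Theorem B, Andrews–Curtis substitution in dimension 5; Gompf 1991 p. 1/p. 4). Open specimens: length-3 killers of non-ribbon 2-knot groups. -/
theorem stub_lengthThree : open scoped ContDiff in ∀ (M : Type) [TopologicalSpace M] [T2Space M] [SecondCountableTopology M] [ChartedSpace (EuclideanSpace ℝ (Fin 4)) M] [IsManifold (𝓡 4) ∞ M], ContinuousMap.HomotopyEquiv M (Metric.sphere (0 : EuclideanSpace ℝ (Fin 5)) 1) → ∀ ν : Literature.Topology.FourManifolds.FramedSphereFamily ((𝓡 2).prod (𝓡 2)) ((Metric.sphere (0 : EuclideanSpace ℝ (Fin 3)) 1) × (Metric.sphere (0 : EuclideanSpace ℝ (Fin 3)) 1)) (Fin 1) 2 2, Manifold.IsSmoothEmbedding (𝓡 2) ((𝓡 2).prod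 (𝓡 2)) ∞ (ν.sphere 0) → (∃ (x : Metric.sphere (0 : EuclideanSpace ℝ (Fin 3)) 1) (F G : C(Metric.sphere (0 : EuclideanSpace ℝ (Fin 3)) 1, (Metric.sphere (0 : EuclideanSpace ℝ (Fin 3)) 1) × (Metric.sphere (0 : EuclideanSpace ℝ (Fin 3)) 1))), ⇑F = ν.sphere 0 ∧ ⇑G = (fun p => (x, p)) ∧ F.Homotopic G) → SimplyConnectedSpace ↥(Set.range (ν.sphere 0))ᶜ → ν.IsSurgery (𝓡 4) M → (∃ x' : Metric.sphere (0 : EuclideanSpace ℝ (Fin 3)) 1, ∀ p, (ν.sphere 0 p).1 ≠ x') → ¬ (∃ y₀ : Metric.sphere (0 : EuclideanSpace ℝ (Fin 3)) 1, ∃! p : Metric.sphere (0 : EuclideanSpace ℝ (Fin 3)) 1, (ν.sphere 0 p).2 = y₀) → (∃ y₀ : Metric.sphere (0 : EuclideanSpace ℝ (Fin 3)) 1, ∃ U ∈ nhds y₀, ∀ y ∈ U, ∃ s : Finset (Metric.sphere (0 : EuclideanSpace ℝ (Fin 3)) 1), s.card ≤ 3 ∧ ∀ p : Metric.sphere (0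 : EuclideanSpace ℝ (Fin 3)) 1, (ν.sphere 0 p).2 = y → p ∈ s) → Nonempty (M ≃ₘ⟮𝓡 4, 𝓡 4⟯ Metric.sphere (0 : EuclideanSpace ℝ (Fin 5)) 1) := by
  sorry

/-- stub · LOAD-BEARING · species R: length-tail cancellation AS GIVEN (neither dual-once nor three-sheeted section) — SATL in costume by the fold move (kernel `lengthTail_iff_satl`); honest specimens: killers of meridional length ≥ 5 (Silver–Whitten–Williams 2010; T-KILLER-R: 28 groups with shortest non-meridional killer of length 5; AK/Gompf rows `aⁿ⁺¹b⁻ⁿ`, n ≥ 2). -/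
theorem stub_lengthTail : open scoped ContDiff in ∀ (M : Type) [TopologicalSpace M] [T2Space M] [SecondCountableTopology M] [ChartedSpace (EuclideanSpace ℝ (Fin 4)) M] [IsManifold (𝓡 4) ∞ M], ContinuousMap.HomotopyEquiv M (Metric.sphere (0 : EuclideanSpace ℝ (Fin 5)) 1) → ∀ ν : Literature.Topology.FourManifolds.FramedSphereFamily ((𝓡 2).prod (𝓡 2)) ((Metric.sphere (0 : EuclideanSpace ℝ (Fin 3)) 1) × (Metric.sphere (0 : EuclideanSpace ℝ (Fin 3)) 1)) (Fin 1) 2 2, Manifold.IsSmoothEmbedding (𝓡 2) ((𝓡 2).prod (𝓡 2)) ∞ (ν.sphere 0) → (∃ (x : Metric.sphere (0 : EuclideanSpace ℝ (Fin 3)) 1) (F G : C(Metric.sphere (0 : EuclideanSpace ℝ (Fin 3)) 1, (Metric.sphere (0 : EuclideanSpace ℝ (Fin 3)) 1) × (Metric.sphere (0 : EuclideanSpace ℝ (Fin 3)) 1))), ⇑F = ν.sphere 0 ∧ ⇑G = (fun p => (x, p)) ∧ F.Homotopic G) → SimplyConnectedSpace ↥(Set.range (ν.sphere 0))ᶜ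 → ν.IsSurgery (𝓡 4) M → (∃ x' : Metric.sphere (0 : EuclideanSpace ℝ (Fin 3)) 1, ∀ p, (ν.sphere 0 p).1 ≠ x') → ¬ (∃ y₀ : Metric.sphere (0 : EuclideanSpace ℝ (Fin 3)) 1, ∃! p : Metric.sphere (0 : EuclideanSpace ℝ (Fin 3)) 1, (ν.sphere 0 p).2 = y₀) → ¬ (∃ y₀ : Metric.sphere (0 : EuclideanSpace ℝ (Fin 3)) 1, ∃ U ∈ nhds y₀, ∀ y ∈ U, ∃ s : Finset (Metric.sphere (0 : EuclideanSpace ℝ (Fin 3)) 1), s.card ≤ 3 ∧ ∀ p : Metric.sphere (0 : EuclideanSpace ℝ (Fin 3)) 1, (ν.sphere 0 p).2 = y → p ∈ s) → Nonempty (M ≃ₘ⟮𝓡 4, 𝓡 4⟯ Metric.sphere (0 : EuclideanSpace ℝ (Fin 5)) 1) := by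
  sorry

/-- COMPOSITION (sorry-free; proof-of-item for C.StableMirrorCancellation #28014 BY NAME, W1 form). -/
theorem StableMirrorCancellation_of (hD : ThreeFibres.SurgeryDictionary) : Summit.SmoothPoincare4.SmoothPoincare4.Theses.RootDecompC.StableMirrorCancellation := by
  intro S _ hstab
  obtain ⟨e⟩ := S.nonempty_homotopyEquiv
  obtain ⟨ν, hemb, hcls, hsc, hsurg⟩ := hD S.carrier e hstab
  obtain ⟨ψ, x', hψ⟩ := stub_twinSeparation ν hemb hcls hsc
  obtain ⟨ν', hemb', hcls', hsc', hsurg', hoff'⟩ := stub_transport S.carrier e ν hemb hcls hsc hsurg ⟨ψ, x', hψ⟩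
  by_cases hd : (∃ y₀ : Metric.sphere (0 : EuclideanSpace ℝ (Fin 3)) 1, ∃! p : Metric.sphere (0 : EuclideanSpace ℝ (Fin 3)) 1, (ν'.sphere 0 p).2 = y₀)
  · exact stub_dualOnceOff S.carrier e ν' hemb' hcls' hsc' hsurg' hoff' hd
  · by_cases hs : (∃ y₀ : Metric.sphere (0 : EuclideanSpace ℝ (Fin 3)) 1, ∃ U ∈ nhds y₀, ∀ y ∈ U, ∃ s : Finset (Metric.sphere (0 : EuclideanSpace ℝ (Fin 3)) 1), s.card ≤ 3 ∧ ∀ p : Metric.sphere (0 : EuclideanSpace ℝ (Fin 3)) 1, (ν'.sphere 0 p).2 = y → p ∈ s)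
    · exact stub_lengthThree S.carrier e ν' hemb' hcls' hsc' hsurg' hoff' hd hs
    · exact stub_lengthTail S.carrier e ν' hemb' hcls' hsc' hsurg' hoff' hd hs

/-- info: 'Summit.SmoothPoincare4.SmoothPoincare4.Cruxes.StableMirrorCancellation.KillerLength.StableMirrorCancellation_of' depends on axioms: [propext, sorryAx, Classical.choice, Quot.sound] -/
#guard_msgs (whitespace := lax) in #print axioms StableMirrorCancellation_of

end Summit.SmoothPoincare4.SmoothPoincare4.Cruxes.StableMirrorCancellation.KillerLength
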